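import Summits.NavierStokesRegularity.NavierStokesRegularity.Theorems.StrainDoorsSliceVorticitySuperlevel
import Summits.NavierStokesRegularity.NavierStokesRegularity.Theorems.StrainDoorsDoorXClosed
import HarnessLib

/-!
# Strain doors, PART M §M33(f) — DOORS Y_μ AND Y_ens CLOSED (and Y∞ a second time, through Y_μ)

ROUND 72 of the `ns-regularity-ideate` p1 line (helper lane of `stmt-NavierStokesRegularity-0056`, rung N0;
nothing here is a claim about Navier–Stokes regularity — a-priori STRUCTURE of a HYPOTHETICAL singularity of a
solution which is Type I in the sup-norm; nothing about Type II).

THIS FILE (text N13b of ROUND 72): ★★★★ `sliceVorticitySuperlevelSupTypeI_holds : SliceVorticitySuperlevelSupTypeI`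
(door Y_μ, UNCONDITIONAL: door X `sliceL3Concentration_holds` of ROUND 70 + N13a), ★★★
`sliceEnstrophyFloorSupTypeI_holds : SliceEnstrophyFloorSupTypeI` (door Y_ens), and the
every-sequence form `superlevel_measure_floor_along_sequences` (door Y∞ through Y_μ is N13a's
`sliceVorticityFloorSupTypeI_of_superlevel`; the planner's corollary `sliceVorticityFloorSupTypeI_holds'` restating the
tree's `sliceVorticityFloorSupTypeI_holds` of ROUND 71 is omitted at landing — hand ns-s29-p2 g7, gate `dedup.landed`).  No definitions.  No `sorry`, no new axioms.
-/

noncomputable section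
set_option linter.dupNamespace false
open MeasureTheory Set Function Filter Metric Real InnerProductSpace
open _root_.Topology
open scoped ENNReal NNReal RealInnerProductSpace ContDiff
open Literature.Analysis Literature.Analysis.FluidPDE Literature.Analysis.FluidPDE.LocalTypeIBlowup

namespace Summit.NavierStokesRegularity.NavierStokesRegularity.Theorems.StrainDoors

/-- ★★★★ **DOOR Y_μ CLOSED**: the `M`-only, every-time, similarity-scale MEASURE floor of the scaled vorticity
superlevel set at sup-norm Type-I singular points — `SliceVorticitySuperlevelSupTypeI` holds unconditionally
(door X `sliceL3Concentration_holds` + `sliceVorticitySuperlevelSupTypeI_of_sliceL3Concentration`).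
[cite: BarkerPrange2021, p. 6 and Remark 5 (arXiv:2003.06717); BarkerPrange2020Alignment, §4 (arXiv:1906.08225);
KochNadirashviliSereginSverak2009, Remark 6.1] -/
theorem sliceVorticitySuperlevelSupTypeI_holds : SliceVorticitySuperlevelSupTypeI :=
  sliceVorticitySuperlevelSupTypeI_of_sliceL3Concentration sliceL3Concentration_holds

/-- ★★★★ **DOOR Y_ens CLOSED**: the `M`-only, every-time local ENSTROPHY floor
`∫_{B(x₀,R(M)√(T−t))}|ω(t)|² ≥ e(M)/√(T − t)` at sup-norm Type-I singular points (the sup-norm-class, `M`-only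
counterpart of Barker–Prange 2021 p. 6 / Remark 5, there with explicit constants in the `L^{3,∞}` class).
[cite: BarkerPrange2021, p. 6, Remark 5 and Thm 3 (arXiv:2003.06717); BarkerPrange2020Alignment, §4] -/
theorem sliceEnstrophyFloorSupTypeI_holds : SliceEnstrophyFloorSupTypeI :=
  sliceEnstrophyFloorSupTypeI_of_superlevel sliceVorticitySuperlevelSupTypeI_holds

/-- ★★★ **EVERY-SEQUENCE FORM OF DOOR Y_μ** (the shape consumed by blow-up arguments along `s_n → T`): for
`M` there are `R, d, μ > 0` such that at a sup-Type-I singular point, along EVERY sequence of times `s_n ↑ T`,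
eventually `|{x ∈ B(x₀,R√(T−s_n)) : (T − s_n)|ω(x,s_n)| > d}| ≥ μ(T − s_n)^{3/2}`.
[cite: BarkerPrange2021, p. 6 and Remark 5 (arXiv:2003.06717); BarkerPrange2020Alignment, §4] -/
theorem superlevel_measure_floor_along_sequences (M : ℝ) :
    ∃ R d μ : ℝ, 0 < R ∧ 0 < d ∧ 0 < μ ∧
      ∀ (T : ℝ) (u : ℝ → EuclideanSpace ℝ (Fin 3) → EuclideanSpace ℝ (Fin 3))
        (p : ℝ → EuclideanSpace ℝ (Fin 3) → ℝ), 0 < T →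
        IsClassicalNSSolutionOn (Ico 0 T) 1 0 u p → IsLerayHopfOn T 1 0 (u 0) u →
        (∀ t ∈ Ioo 0 T, ∀ x : EuclideanSpace ℝ (Fin 3), ‖u t x‖ ≤ M / Real.sqrt (T - t)) →
        ∀ x₀ : EuclideanSpace ℝ (Fin 3), IsBackwardSingularPoint u (T, x₀) →
          ∀ s : ℕ → ℝ, (∀ n, s n < T) → Tendsto s atTop (𝓝 T) →
            ∀ᶠ n in atTop, ENNReal.ofReal (μ * Real.sqrt (T - s n) ^ 3) ≤
              volume {x ∈ ball x₀ (R * Real.sqrt (T - s n)) | d < (T - s n) * ‖curl (u (s n)) x‖} := by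
  obtain ⟨R, d, μ, hR, hd, hμ, hY⟩ := sliceVorticitySuperlevelSupTypeI_holds M
  refine ⟨R, d, μ, hR, hd, hμ, ?_⟩
  intro T u p hT hcl hLH hI x₀ hsing s hsT hlim
  obtain ⟨t₁, ht₁, hfl⟩ := hY T u p hT hcl hLH hI x₀ hsing
  have hev : ∀ᶠ n in atTop, t₁ < s n := hlim.eventually (Ioi_mem_nhds ht₁)
  exact hev.mono fun n hn => hfl (s n) ⟨hn, hsT n⟩

end Summit.NavierStokesRegularity.NavierStokesRegularity.Theorems.StrainDoors

end
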